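import Mathlib
import HarnessLib
import Summits.Ventures.LatticeQCDFlow.Scoring.ChainLagProductAverages

/-!
# The SAMPLE autocovariance (centred at the sample mean) converges in `L¹` from any start:
# `E_{μ₀} |γ̂_{k,N} − γ_k| ≤ R_k/√(N−k) + 4C²k/N + 4C·D/√N + D²/N`

HONEST FRAMING: exact (Metropolis-corrected) sampling algorithms for lattice gauge theory;
figures of merit are autocorrelation/cost numbers at stated couplings and volumes; no
continuum-physics claim.

Venture `LatticeQCDFlow` (cell pub-lqcd), topic `Scoring`; FANOUT row 4 (`s0-u1-b`, GEN-31).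
NEW WORK of the cell, not a published result; no definition is introduced; nothing is cited as a
fact.  Setting of `Scoring/ChainLagProductAverages.lean` (kernel `κ`, invariant `π`, geometric
envelope `(A, ρ)`, `|f| ≤ C` measurable, chain from ANY law `μ₀`, `f̄ = f − πf`,
`γ_k = autocov κ π f̄ k`).  The estimator a run actually computes centres at the SAMPLE mean:
with `m̂_N = (1/N) Σ_{j<N} f(X_j)` and `k < N`,
`γ̂_{k,N} = (1/N) Σ_{i<N−k} (f(X_i) − m̂_N)(f(X_{i+k}) − m̂_N)` (the `1/N` convention, `N` samples).
Writing `δ = m̂_N − πf`, pathwise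
`N γ̂_{k,N} = Σ_{i<N−k} f̄(X_i) f̄(X_{i+k}) − δ Σ_{i<N−k} (f̄(X_i) + f̄(X_{i+k})) + (N−k) δ²`, so
`|γ̂_{k,N} − γ_k| ≤ |(1/(N−k)) Σ_{i<N−k} f̄(X_i) f̄(X_{i+k}) − γ_k| + 4C²k/N + 4C|δ| + δ²`, and the
known-mean law of large numbers for lag products, `E|δ| ≤ D/√N`, `E δ² ≤ D²/N`
(`D = √10·4CA/(1−ρ)`, `Scoring/GeometricEnvelopeBlockSumMoments.lean`) give the title with
`R_k = 8C² (√(2k+1) + 2√10·A/(1−ρ))`.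

## Content

* `sum_centred_lagProduct_eq` — the pathwise identity (any reals `m`, `m̂`);
* `chain_sampleMean_sub_sq_integral_le_of_envelope`, `chain_sampleMean_sub_abs_integral_le_of_envelope`
  — `E_{μ₀} δ² ≤ D²/N`, `E_{μ₀}|δ| ≤ D/√N`;
* **`chain_sampleAutocovariance_abs_sub_le_of_envelope`** — the theorem in the title.

NOT CLAIMED: the `1/(N−k)` normalisation (differs by `(k/N) γ̂`); optimal constants; unbounded `f`.
-/

noncomputable section

namespace Summit.Ventures.LatticeQCDFlow.Scoring

open MeasureTheory ProbabilityTheory Filter Finset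
open scoped ENNReal Topology

variable {Ω : Type*} [MeasurableSpace Ω]

/-! ### The pathwise identity -/

/-- Re-centring a lag-product sum: for any reals `m`, `m̂` and any sequence `u`,
`Σ_{i<M} (u_i − m̂)(u_{i+k} − m̂)
   = Σ_{i<M} (u_i − m)(u_{i+k} − m) − (m̂ − m) Σ_{i<M} ((u_i − m) + (u_{i+k} − m)) + M (m̂ − m)²`. -/
theorem sum_centred_lagProduct_eq (u : ℕ → ℝ) (m mh : ℝ) (M k : ℕ) :
    ∑ i ∈ Finset.range M, (u i - mh) * (u (i + k) - mh)
      = (∑ i ∈ Finset.range M, (u i - m) * (u (i + k) - m))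
        - (mh - m) * (∑ i ∈ Finset.range M, ((u i - m) + (u (i + k) - m)))
        + M * (mh - m) ^ 2 := by
  have h : ∀ i, (u i - mh) * (u (i + k) - mh)
      = (u i - m) * (u (i + k) - m) - (mh - m) * ((u i - m) + (u (i + k) - m)) + (mh - m) ^ 2 :=
    fun i => by ring
  rw [Finset.sum_congr rfl fun i _ => h i, Finset.sum_add_distrib, Finset.sum_sub_distrib,
    ← Finset.mul_sum, Finset.sum_const, Finset.card_range, nsmul_eq_mul]

section Chain

variable {κ : Kernel Ω Ω} [IsMarkovKernel κ] {π : Measure Ω} [IsProbabilityMeasure π] {A ρ : ℝ}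

/-- **`E_{μ₀}[(m̂_N − πf)²] ≤ 10 (4CA/(1−ρ))²/N`**: the sample mean from any start (envelope). -/
theorem chain_sampleMean_sub_sq_integral_le_of_envelope
    (henv : ∀ (g : Ω → ℝ), Measurable g → ∀ (Cg : ℝ), (∀ x, |g x| ≤ Cg) →
      ∀ (t : ℕ) (x : Ω), |(kop κ)^[t] g x - ∫ y, g y ∂π| ≤ 2 * Cg * (A * ρ ^ t))
    (hρ0 : 0 ≤ ρ) (hρ1 : ρ < 1) {f : Ω → ℝ} (hf : Measurable f) {C : ℝ} (hC : ∀ x, |f x| ≤ C)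
    (μ₀ : Measure Ω) [IsProbabilityMeasure μ₀] {N : ℕ} (hN : N ≠ 0) :
    ∫ x, ((∑ j ∈ Finset.range N, f (x j)) / N - ∫ z, f z ∂π) ^ 2
        ∂(Kernel.trajMeasure (X := fun _ : ℕ => Ω) (μ₀)
          (fun n : ℕ => κ.comap (fun h' : (i : ↥(Finset.Iic n)) → Ω => h' ⟨n, Finset.mem_Iic.2 le_rfl⟩)
            (measurable_pi_apply _)))
      ≤ 10 * (4 * C * A / (1 - ρ)) ^ 2 / N := by
  have hNpos : (0 : ℝ) < N := by exact_mod_cast Nat.pos_of_ne_zero hN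
  have hN0 : (N : ℝ) ≠ 0 := hNpos.ne'
  have h2 := chain_blockSum_sq_le_of_envelope (κ := κ) henv hρ0 hρ1 hf hC μ₀ 0 hN
  simp only [zero_add] at h2
  have hsub : ∀ x : ℕ → Ω, (∑ j ∈ Finset.range N, f (x j)) / N - ∫ z, f z ∂π
      = (∑ t ∈ Finset.range N, (f (x t) - ∫ z, f z ∂π)) / N := fun x => by
    rw [Finset.sum_sub_distrib, Finset.sum_const, Finset.card_range, nsmul_eq_mul, sub_div,
      mul_div_cancel_left₀ _ hN0]
  have hpt : ∀ x : ℕ → Ω, ((∑ j ∈ Finset.range N, f (x j)) / N - ∫ z, f z ∂π) ^ 2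
      = (∑ t ∈ Finset.range N, (f (x t) - ∫ z, f z ∂π)) ^ 2 / (N : ℝ) ^ 2 := fun x => by
    rw [hsub x, div_pow]
  rw [integral_congr_ae (ae_of_all _ hpt), integral_div]
  refine (div_le_div_of_nonneg_right h2 (by positivity)).trans (le_of_eq ?_)
  rw [div_eq_div_iff (by positivity) hN0]
  ring

/-- **`E_{μ₀}|m̂_N − πf| ≤ √10 (4CA/(1−ρ))/√N`** (`0 ≤ A`). -/
theorem chain_sampleMean_sub_abs_integral_le_of_envelope
    (henv : ∀ (g : Ω → ℝ), Measurable g → ∀ (Cg : ℝ), (∀ x, |g x| ≤ Cg) →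
      ∀ (t : ℕ) (x : Ω), |(kop κ)^[t] g x - ∫ y, g y ∂π| ≤ 2 * Cg * (A * ρ ^ t))
    (hA : 0 ≤ A) (hρ0 : 0 ≤ ρ) (hρ1 : ρ < 1) {f : Ω → ℝ} (hf : Measurable f) {C : ℝ} (hC : ∀ x, |f x| ≤ C)
    (μ₀ : Measure Ω) [IsProbabilityMeasure μ₀] {N : ℕ} (hN : N ≠ 0) :
    ∫ x, |(∑ j ∈ Finset.range N, f (x j)) / N - ∫ z, f z ∂π|
        ∂(Kernel.trajMeasure (X := fun _ : ℕ => Ω) (μ₀)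
          (fun n : ℕ => κ.comap (fun h' : (i : ↥(Finset.Iic n)) → Ω => h' ⟨n, Finset.mem_Iic.2 le_rfl⟩)
            (measurable_pi_apply _)))
      ≤ Real.sqrt 10 * (4 * C * A / (1 - ρ)) / Real.sqrt N := by
  have hC0 : 0 ≤ C := (abs_nonneg _).trans (hC (Classical.choice (nonempty_of_isProbabilityMeasure μ₀)))
  have h1ρ : 0 < 1 - ρ := sub_pos.2 hρ1
  have hNpos : (0 : ℝ) < N := by exact_mod_cast Nat.pos_of_ne_zero hN
  obtain ⟨hfb, hCfb, -⟩ := centred_observable_bounds π hf hC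
  have hm : Measurable fun x : ℕ → Ω => (∑ j ∈ Finset.range N, f (x j)) / N - ∫ z, f z ∂π :=
    ((Finset.measurable_sum _ fun j _ => hf.comp (measurable_pi_apply _)).div_const _).sub_const _
  have hN0 : (N : ℝ) ≠ 0 := hNpos.ne'
  have hb : ∀ x : ℕ → Ω, |(∑ j ∈ Finset.range N, f (x j)) / N - ∫ z, f z ∂π| ≤ 2 * C := by
    intro x
    have : (∑ j ∈ Finset.range N, f (x j)) / N - ∫ z, f z ∂π
        = (∑ j ∈ Finset.range N, (f (x j) - ∫ z, f z ∂π)) / N := by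
      rw [Finset.sum_sub_distrib, Finset.sum_const, Finset.card_range, nsmul_eq_mul, sub_div,
        mul_div_cancel_left₀ _ hN0]
    rw [this, abs_div, abs_of_pos hNpos, div_le_iff₀ hNpos]
    calc |∑ j ∈ Finset.range N, (f (x j) - ∫ z, f z ∂π)| ≤ ∑ j ∈ Finset.range N, |f (x j) - ∫ z, f z ∂π| :=
          Finset.abs_sum_le_sum_abs _ _
      _ ≤ ∑ _j ∈ Finset.range N, 2 * C := Finset.sum_le_sum fun j _ => hCfb _
      _ = 2 * C * N := by rw [Finset.sum_const, Finset.card_range, nsmul_eq_mul]; ring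
  have h4 := chain_sampleMean_sub_sq_integral_le_of_envelope (κ := κ) henv hρ0 hρ1 hf hC μ₀ hN
  refine (integral_abs_le_sqrt_integral_sq _ hm hb).trans ((Real.sqrt_le_sqrt h4).trans (le_of_eq ?_))
  rw [Real.sqrt_div' _ hNpos.le, Real.sqrt_mul (by positivity), Real.sqrt_sq (by positivity)]

/-- **THE SAMPLE AUTOCOVARIANCE CONVERGES IN `L¹` FROM ANY START.**  Envelope `(A, ρ)` (`0 ≤ A`,
`0 ≤ ρ < 1`), `|f| ≤ C` measurable, `f̄ = f − πf`, `γ_k = autocov κ π f̄ k`; for every initial law,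
every `k < N`, with `m̂_N = (1/N) Σ_{j<N} f(X_j)`:
`E_{μ₀} |(1/N) Σ_{i<N−k} (f(X_i) − m̂_N)(f(X_{i+k}) − m̂_N) − γ_k|
   ≤ 8C² (√(2k+1) + 2√10·A/(1−ρ))/√(N−k) + 4C²k/N + 4C·(√10·4CA/(1−ρ))/√N + 10 (4CA/(1−ρ))²/N`. -/
theorem chain_sampleAutocovariance_abs_sub_le_of_envelope
    (henv : ∀ (g : Ω → ℝ), Measurable g → ∀ (Cg : ℝ), (∀ x, |g x| ≤ Cg) →
      ∀ (t : ℕ) (x : Ω), |(kop κ)^[t] g x - ∫ y, g y ∂π| ≤ 2 * Cg * (A * ρ ^ t))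
    (hA : 0 ≤ A) (hρ0 : 0 ≤ ρ) (hρ1 : ρ < 1) {f : Ω → ℝ} (hf : Measurable f) {C : ℝ} (hC : ∀ x, |f x| ≤ C)
    (μ₀ : Measure Ω) [IsProbabilityMeasure μ₀] {k N : ℕ} (hkN : k < N) :
    ∫ x, |(∑ i ∈ Finset.range (N - k), (f (x i) - (∑ j ∈ Finset.range N, f (x j)) / N)
              * (f (x (i + k)) - (∑ j ∈ Finset.range N, f (x j)) / N)) / N
            - autocov κ π (fun y => f y - ∫ z, f z ∂π) k|
        ∂(Kernel.trajMeasure (X := fun _ : ℕ => Ω) (μ₀)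
          (fun n : ℕ => κ.comap (fun h' : (i : ↥(Finset.Iic n)) → Ω => h' ⟨n, Finset.mem_Iic.2 le_rfl⟩)
            (measurable_pi_apply _)))
      ≤ 8 * C ^ 2 * (Real.sqrt (2 * k + 1) + 2 * Real.sqrt 10 * A / (1 - ρ)) / Real.sqrt ((N - k : ℕ))
        + 4 * C ^ 2 * k / N + 4 * C * (Real.sqrt 10 * (4 * C * A / (1 - ρ))) / Real.sqrt N
        + 10 * (4 * C * A / (1 - ρ)) ^ 2 / N := by
  set P := (Kernel.trajMeasure (X := fun _ : ℕ => Ω) (μ₀)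
        (fun n : ℕ => κ.comap (fun h' : (i : ↥(Finset.Iic n)) → Ω => h' ⟨n, Finset.mem_Iic.2 le_rfl⟩)
          (measurable_pi_apply _))) with hP
  have hC0 : 0 ≤ C := (abs_nonneg _).trans (hC (Classical.choice (nonempty_of_isProbabilityMeasure μ₀)))
  have h1ρ : 0 < 1 - ρ := sub_pos.2 hρ1
  have hN : N ≠ 0 := by omega
  have hM : N - k ≠ 0 := by omega
  have hNpos : (0 : ℝ) < N := by exact_mod_cast Nat.pos_of_ne_zero hN
  have hMpos : (0 : ℝ) < ((N - k : ℕ) : ℝ) := by exact_mod_cast Nat.pos_of_ne_zero hM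
  have hN0 : (N : ℝ) ≠ 0 := hNpos.ne'
  have hMN : (((N - k : ℕ) : ℝ)) = N - k := by rw [Nat.cast_sub hkN.le]
  obtain ⟨hfb, hCfb, -⟩ := centred_observable_bounds π hf hC
  set c : ℝ := ∫ z, f z ∂π with hc
  set γ : ℝ := autocov κ π (fun y => f y - c) k with hγ
  have hγb : |γ| ≤ 2 * C * (2 * C) := by
    rw [hγ]; unfold autocov
    obtain ⟨hkm, hkb⟩ := iterate_kop_bounded_measurable κ hfb hCfb k
    calc |∫ y, (f y - c) * (kop κ)^[k] (fun y => f y - c) y ∂π|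
        = ‖∫ y, (f y - c) * (kop κ)^[k] (fun y => f y - c) y ∂π‖ := (Real.norm_eq_abs _).symm
      _ ≤ 2 * C * (2 * C) * π.real Set.univ := norm_integral_le_of_norm_le_const
          (Eventually.of_forall fun y => by
            rw [Real.norm_eq_abs, abs_mul]
            exact mul_le_mul (hCfb y) (hkb y) (abs_nonneg _) (by positivity))
      _ = 2 * C * (2 * C) := by rw [probReal_univ, mul_one]
  -- the statistic, pathwise: `δ = m̂ − c`, `v_i = f(x_i) − c`
  set δ : (ℕ → Ω) → ℝ := fun x => (∑ j ∈ Finset.range N, f (x j)) / N - c with hδ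
  set L : (ℕ → Ω) → ℝ := fun x =>
    (∑ i ∈ Finset.range (N - k), (f (x i) - c) * (f (x (i + k)) - c)) / ((N - k : ℕ) : ℝ) - γ with hL
  set S : (ℕ → Ω) → ℝ := fun x => ∑ i ∈ Finset.range (N - k), ((f (x i) - c) + (f (x (i + k)) - c)) with hS
  have hSb : ∀ x, |S x| ≤ ((N - k : ℕ) : ℝ) * (4 * C) := fun x =>
    (Finset.abs_sum_le_sum_abs _ _).trans (by
      calc ∑ i ∈ Finset.range (N - k), |(f (x i) - c) + (f (x (i + k)) - c)|
          ≤ ∑ _i ∈ Finset.range (N - k), 4 * C := Finset.sum_le_sum fun i _ =>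
            (abs_add_le _ _).trans (by linarith [hCfb (x i), hCfb (x (i + k))])
        _ = ((N - k : ℕ) : ℝ) * (4 * C) := by rw [Finset.sum_const, Finset.card_range, nsmul_eq_mul])
  -- pathwise identity
  have hpt : ∀ x : ℕ → Ω,
      (∑ i ∈ Finset.range (N - k), (f (x i) - (∑ j ∈ Finset.range N, f (x j)) / N)
          * (f (x (i + k)) - (∑ j ∈ Finset.range N, f (x j)) / N)) / N - γ
        = ((N - k : ℕ) : ℝ) / N * L x - k / N * γ - δ x * (S x / N) + ((N - k : ℕ) : ℝ) / N * δ x ^ 2 := by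
    intro x
    have hmh : (∑ j ∈ Finset.range N, f (x j)) / N = c + δ x := by rw [hδ]; ring
    rw [hmh]
    have hid := sum_centred_lagProduct_eq (fun i => f (x i)) c (c + δ x) (N - k) k
    simp only [add_sub_cancel_left] at hid
    rw [hid]
    have eL : (∑ i ∈ Finset.range (N - k), (f (x i) - c) * (f (x (i + k)) - c))
        = ((N - k : ℕ) : ℝ) * (L x + γ) := by
      rw [hL]
      show _ = ((N - k : ℕ) : ℝ) * ((∑ i ∈ Finset.range (N - k), (f (x i) - c) * (f (x (i + k)) - c))
        / ((N - k : ℕ) : ℝ) - γ + γ)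
      rw [sub_add_cancel, mul_div_cancel₀ _ hMpos.ne']
    have eS : (∑ i ∈ Finset.range (N - k), ((f (x i) - c) + (f (x (i + k)) - c))) = S x := rfl
    rw [eL, eS, hMN]
    field_simp
    ring
  -- pathwise bound
  have hbd : ∀ x : ℕ → Ω,
      |(∑ i ∈ Finset.range (N - k), (f (x i) - (∑ j ∈ Finset.range N, f (x j)) / N)
          * (f (x (i + k)) - (∑ j ∈ Finset.range N, f (x j)) / N)) / N - γ|
        ≤ |L x| + 4 * C ^ 2 * k / N + 4 * C * |δ x| + δ x ^ 2 := by
    intro x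
    rw [hpt x]
    have hr : ((N - k : ℕ) : ℝ) / N ≤ 1 := by rw [div_le_one hNpos, hMN]; linarith [(Nat.cast_nonneg k : (0:ℝ) ≤ k)]
    have hr0 : 0 ≤ ((N - k : ℕ) : ℝ) / N := by positivity
    have t1 : |((N - k : ℕ) : ℝ) / N * L x| ≤ |L x| := by
      rw [abs_mul, abs_of_nonneg hr0]; exact mul_le_of_le_one_left (abs_nonneg _) hr
    have t2 : |(k : ℝ) / N * γ| ≤ 4 * C ^ 2 * k / N := by
      rw [abs_mul, abs_of_nonneg (by positivity : (0 : ℝ) ≤ k / N)]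
      calc (k : ℝ) / N * |γ| ≤ k / N * (2 * C * (2 * C)) := mul_le_mul_of_nonneg_left hγb (by positivity)
        _ = 4 * C ^ 2 * k / N := by ring
    have t3 : |δ x * (S x / N)| ≤ 4 * C * |δ x| := by
      rw [abs_mul, mul_comm]
      refine mul_le_mul_of_nonneg_right ?_ (abs_nonneg _)
      rw [abs_div, abs_of_pos hNpos, div_le_iff₀ hNpos]
      calc |S x| ≤ ((N - k : ℕ) : ℝ) * (4 * C) := hSb x
        _ ≤ N * (4 * C) := by rw [hMN]; nlinarith [(Nat.cast_nonneg k : (0:ℝ) ≤ k)]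
        _ = 4 * C * N := by ring
    have t4 : |((N - k : ℕ) : ℝ) / N * δ x ^ 2| ≤ δ x ^ 2 := by
      rw [abs_mul, abs_of_nonneg hr0, abs_of_nonneg (sq_nonneg _)]
      exact mul_le_of_le_one_left (sq_nonneg _) hr
    have key : ∀ a b e d : ℝ, |a - b - e + d| ≤ |a| + |b| + |e| + |d| := fun a b e d => by
      have h1 : |a - b - e + d| ≤ |a - b - e| + |d| := abs_add_le _ _
      have h2 : |a - b - e| ≤ |a - b| + |e| := abs_sub _ _
      have h3 : |a - b| ≤ |a| + |b| := abs_sub _ _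
      linarith
    exact (key _ _ _ _).trans (by linarith [t1, t2, t3, t4])
  -- measurability / integrability
  have hvm : ∀ i, Measurable fun x : ℕ → Ω => f (x i) - c := fun i => (hf.comp (measurable_pi_apply i)).sub_const _
  have hLm : Measurable L := ((Finset.measurable_sum _ fun i _ => (hvm i).mul (hvm (i + k))).div_const _).sub_const _
  have hδm : Measurable δ := ((Finset.measurable_sum _ fun j _ => hf.comp (measurable_pi_apply _)).div_const _).sub_const _
  have hLb : ∀ x, |L x| ≤ 2 * C * (2 * C) + 2 * C * (2 * C) := by
    intro x
    refine (abs_sub _ _).trans (add_le_add ?_ hγb)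
    rw [abs_div, abs_of_pos hMpos, div_le_iff₀ hMpos]
    calc |∑ i ∈ Finset.range (N - k), (f (x i) - c) * (f (x (i + k)) - c)|
        ≤ ∑ i ∈ Finset.range (N - k), |(f (x i) - c) * (f (x (i + k)) - c)| := Finset.abs_sum_le_sum_abs _ _
      _ ≤ ∑ _i ∈ Finset.range (N - k), 2 * C * (2 * C) := Finset.sum_le_sum fun i _ => by
          rw [abs_mul]; exact mul_le_mul (hCfb _) (hCfb _) (abs_nonneg _) (by positivity)
      _ = 2 * C * (2 * C) * ((N - k : ℕ) : ℝ) := by rw [Finset.sum_const, Finset.card_range, nsmul_eq_mul]; ring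
  have hδb : ∀ x, |δ x| ≤ 2 * C := by
    intro x
    have : δ x = (∑ j ∈ Finset.range N, (f (x j) - c)) / N := by
      rw [hδ, Finset.sum_sub_distrib, Finset.sum_const, Finset.card_range, nsmul_eq_mul, sub_div,
        mul_div_cancel_left₀ _ hNpos.ne']
    rw [this, abs_div, abs_of_pos hNpos, div_le_iff₀ hNpos]
    calc |∑ j ∈ Finset.range N, (f (x j) - c)| ≤ ∑ j ∈ Finset.range N, |f (x j) - c| := Finset.abs_sum_le_sum_abs _ _
      _ ≤ ∑ _j ∈ Finset.range N, 2 * C := Finset.sum_le_sum fun j _ => hCfb _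
      _ = 2 * C * N := by rw [Finset.sum_const, Finset.card_range, nsmul_eq_mul]; ring
  have hI1 : Integrable (fun x => |L x|) P := (integrable_of_bounded P hLm hLb).abs
  have hI3 : Integrable (fun x => 4 * C * |δ x|) P := (integrable_of_bounded P hδm hδb).abs.const_mul _
  have hI4 : Integrable (fun x => δ x ^ 2) P :=
    integrable_of_bounded P (hδm.pow_const 2) (C := (2 * C) ^ 2) fun x => by
      rw [abs_pow]; exact pow_le_pow_left₀ (abs_nonneg _) (hδb x) 2
  -- the three expectations
  have hE1 : ∫ x, |L x| ∂P ≤ 8 * C ^ 2 * (Real.sqrt (2 * k + 1) + 2 * Real.sqrt 10 * A / (1 - ρ))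
      / Real.sqrt ((N - k : ℕ)) := by
    have h1 := chain_sampleAutocov_abs_sub_le_of_envelope (κ := κ) henv hA hρ0 hρ1 hf hC μ₀ k hM
    rw [← hP] at h1
    exact h1
  have hE3 : ∫ x, 4 * C * |δ x| ∂P ≤ 4 * C * (Real.sqrt 10 * (4 * C * A / (1 - ρ)) / Real.sqrt N) := by
    rw [integral_const_mul]
    have h3 := chain_sampleMean_sub_abs_integral_le_of_envelope (κ := κ) henv hA hρ0 hρ1 hf hC μ₀ hN
    rw [← hP] at h3
    exact mul_le_mul_of_nonneg_left h3 (by positivity)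
  have hE4 : ∫ x, δ x ^ 2 ∂P ≤ 10 * (4 * C * A / (1 - ρ)) ^ 2 / N := by
    have h4 := chain_sampleMean_sub_sq_integral_le_of_envelope (κ := κ) henv hρ0 hρ1 hf hC μ₀ hN
    rw [← hP] at h4
    exact h4
  have hI12 : Integrable (fun x => |L x| + 4 * C ^ 2 * k / N) P := hI1.add (integrable_const _)
  have hI123 : Integrable (fun x => |L x| + 4 * C ^ 2 * k / N + 4 * C * |δ x|) P := hI12.add hI3
  have hint : Integrable (fun x => |L x| + 4 * C ^ 2 * k / N + 4 * C * |δ x| + δ x ^ 2) P := hI123.add hI4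
  have step1 : ∫ x, |(∑ i ∈ Finset.range (N - k), (f (x i) - (∑ j ∈ Finset.range N, f (x j)) / N)
            * (f (x (i + k)) - (∑ j ∈ Finset.range N, f (x j)) / N)) / N - γ| ∂P
      ≤ ∫ x, (|L x| + 4 * C ^ 2 * k / N + 4 * C * |δ x| + δ x ^ 2) ∂P :=
    integral_mono_of_nonneg (ae_of_all _ fun x => abs_nonneg _) hint (ae_of_all _ hbd)
  have step2 : ∫ x, (|L x| + 4 * C ^ 2 * k / N + 4 * C * |δ x| + δ x ^ 2) ∂P
      = (∫ x, |L x| ∂P) + 4 * C ^ 2 * k / N + (∫ x, 4 * C * |δ x| ∂P) + ∫ x, δ x ^ 2 ∂P := by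
    rw [integral_add hI123 hI4, integral_add hI12 hI3, integral_add hI1 (integrable_const _),
      integral_const, probReal_univ, one_smul]
  have hfin : 8 * C ^ 2 * (Real.sqrt (2 * k + 1) + 2 * Real.sqrt 10 * A / (1 - ρ)) / Real.sqrt ((N - k : ℕ))
        + 4 * C ^ 2 * k / N + 4 * C * (Real.sqrt 10 * (4 * C * A / (1 - ρ)) / Real.sqrt N)
        + 10 * (4 * C * A / (1 - ρ)) ^ 2 / N
      = 8 * C ^ 2 * (Real.sqrt (2 * k + 1) + 2 * Real.sqrt 10 * A / (1 - ρ)) / Real.sqrt ((N - k : ℕ))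
        + 4 * C ^ 2 * k / N + 4 * C * (Real.sqrt 10 * (4 * C * A / (1 - ρ))) / Real.sqrt N
        + 10 * (4 * C * A / (1 - ρ)) ^ 2 / N := by ring
  linarith [step1, step2, hE1, hE3, hE4, hfin]

end Chain

end Summit.Ventures.LatticeQCDFlow.Scoring

end
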